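import Summits.QuantumAdvantage.QuantumAdvantage.Theses.CompactnessLift
import Summits.QuantumAdvantage.QuantumAdvantage.Theorems.CompactnessLiftCompactnessPrincipleSquareClock
import Summits.QuantumAdvantage.QuantumAdvantage.Theorems.CompactnessLiftCompactnessPrincipleInstMap
import Summits.QuantumAdvantage.QuantumAdvantage.Theorems.CompactnessLiftCompactnessPrincipleTruncRun
import Summits.QuantumAdvantage.QuantumAdvantage.Theorems.CompactnessLiftCompactnessPrinciplePreimage
import Literature.Computability.Complexity.CountingHierarchyProofs
import Literature.Computability.Complexity.CountingHierarchyPPoly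

/-!
# Route CompactnessLift · crux `CompactnessPrinciple` (stmt-QuantumAdvantage-15270) — closed AS TYPED
# by universal-clock padding (line `universal-clock-padding`, square-clock variant)

HONEST LABEL. The route types `BP·DTIME(n^c)` as `bp (DTIME (fun n => n ^ c))`; in the tree's
operator `bp` the coin string has length `p |x|` for an ARBITRARY polynomial `p` and the inner
language is clocked on the padded pair `⟨x, y⟩`, so coins are free padding (refuters rreview-0816 /
rattack-15270-0, `Cruxes/CompactnessPrinciple/Disproof.lean`) and the crux follows from

  `paddingCollapse : ∃ c₀, BPP ⊆ bp (DTIME (fun n => n ^ c₀))`,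

a clocked-simulation theorem with zero quantum content. This is NOT the intended uniform-exponent
principle CP′ over `BQTime`/`BPTime` (which the planner restates); it settles the item as filed.

Proof of `paddingCollapse` (Aaronson–van Melkebeek 2011, §3.3: a complete problem under linear-time
reductions gives ONE exponent; Arora–Barak 2009, Thm. 1.9 / §1.4.1: universal machine with a time
counter). For `L ∈ BPP` presented by `L' ∈ DTIME(n^k)` (machine `M'`) and coins `p`: the inner
language is `{W | ⟨e, ⟨W, ε⟩⟩ ∈ U₂}` where `U₂ ∈ P` is the SQUARE-clocked universal acceptance
language (`stub_squareClock`, sibling of `ClockedUA.U`), `e` codes the pre-processor `M̂` =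
"truncate the coins to `p |x|`, then run `M'`" (`stub_truncRun`, time `A(|x|) + |z|` on `⟨x, z⟩`),
the instance map `W ↦ ⟨e, ⟨W, ε⟩⟩` is linear time (`stub_instMap`), so the inner language lies in
the fixed slice `DTIME(n^{max d 1})`, `d` the exponent of `U₂` (`stub_preimage`). On coin strings
`z` of the prescribed length `p |x| + A |x| + h` the budget inequality `h (A |x| + |z|) ≤ |inst|²`
holds, so by completeness/soundness of `U₂` and determinism (`TM2Std.outputs_unique`) the verdict
is that of `L'` on `⟨x, z ↾ p|x|⟩`, whose success probability is the cylinder probability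
(`uniformProb_take_of_le`, `uniformProb_congr`) `≥ 2/3`. Then `QuadQ ⊆ BQP ⊆ BPP` closes the crux by name
(`compactnessPrinciple_proof`).

## References

* S. Arora, B. Barak, *Computational Complexity: A Modern Approach*, CUP 2009, Thm. 1.9, §1.4.1,
  Def. 7.2–7.3. [AroraBarakCC2009]
* S. Aaronson, D. van Melkebeek, *On circuit lower bounds from derandomization*, Theory of
  Computing 7 (2011) 177–184, §3.3. [AaronsonMelkebeek2011]
-/

-- the `Summit.QuantumAdvantage.QuantumAdvantage.…` namespace repeats summit = sub-problem (D-0017 layout)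
set_option linter.dupNamespace false

noncomputable section

namespace Summit.QuantumAdvantage.QuantumAdvantage.Theorems.CompactnessLiftPadding

open Polynomial
open Literature.Computability.Complexity Literature.Computability.Cryptography
open _root_.Computability (encodeBool)

/-! ### Composition (proved) -/

/-- A deterministic machine has at most one output word on a given input (the `OutputsWithin`
form of `TM2Std.outputs_unique`; twin of `AvM.outputsWithin_unique`, not imported). -/
theorem outputsWithin_unique (M : Turing.TM2ComputableAux Bool Bool) {l l₁ l₂ : List Bool}
    {m₁ m₂ : ℕ} (h₁ : M.OutputsWithin l l₁ m₁) (h₂ : M.OutputsWithin l l₂ m₂) : l₁ = l₂ :=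
  List.map_injective_iff.2 M.outputAlphabet.symm.injective (TM2Std.outputs_unique M.tm h₁ h₂)

/-- The budget arithmetic: with `|z| = p + A + h` coins, `h (A + |z|) ≤ |⟨e, ⟨⟨x, z⟩, ε⟩⟩|²`. -/
theorem budget_le (h A pn el n zl : ℕ) (hz : zl = pn + A + h) :
    h * (A + zl) ≤ (2 * el + 2 + (2 * (2 * n + 2 + zl) + 2 + 0)) ^ 2 := by
  have h1 : h ≤ zl := by omega
  have h2 : A + zl ≤ 2 * zl := by omega
  have h3 : 2 * zl ≤ 2 * el + 2 + (2 * (2 * n + 2 + zl) + 2 + 0) := by omega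
  calc h * (A + zl) ≤ zl * (2 * zl) := Nat.mul_le_mul h1 h2
    _ ≤ (2 * el + 2 + (2 * (2 * n + 2 + zl) + 2 + 0)) *
          (2 * el + 2 + (2 * (2 * n + 2 + zl) + 2 + 0)) := Nat.mul_le_mul (by omega) h3
    _ = (2 * el + 2 + (2 * (2 * n + 2 + zl) + 2 + 0)) ^ 2 := (sq _).symm

/-- **Padding collapse** (the typed content of the crux): ONE exponent `c₀` with
`BPP ⊆ bp (DTIME (fun n => n ^ c₀))`. See the module docstring. -/
theorem paddingCollapse : ∃ c₀ : ℕ, BPP ⊆ bp (DTIME fun n => n ^ c₀) := by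
  obtain ⟨U₂, hU₂P, hU⟩ := stub_squareClock
  obtain ⟨d₀, hd₀⟩ := Set.mem_iUnion.1 hU₂P
  refine ⟨max d₀ 1, ?_⟩
  rintro L ⟨L', hL'P, p, hbp⟩
  obtain ⟨k, hk⟩ := Set.mem_iUnion.1 hL'P
  obtain ⟨a, ha⟩ := hk
  obtain ⟨M', hM'⟩ := ha
  -- the clocked pre-processor `M̂`: truncate the coins to `p |x|`, then run `M'`
  obtain ⟨Mhat, A, hMhat⟩ :=
    stub_truncRun M' (fun v => encodeBool (L'.boolIndicator v)) p a k fun v => hM' v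
  -- its code for the square-clocked universal machine, and the instance map
  obtain ⟨e, h, hcomplete, hsound⟩ := hU Mhat
  obtain ⟨a₁, hρ⟩ := stub_instMap e
  have hL'' : {W : List Bool | boolPair e (boolPair W []) ∈ U₂} ∈ DTIME fun n => n ^ max d₀ 1 :=
    stub_preimage hd₀ hρ
  refine ⟨{W : List Bool | boolPair e (boolPair W []) ∈ U₂}, hL'', p + A + C h, fun x => ?_⟩
  set n := x.length with hn
  -- on coin strings of the prescribed length the verdict is that of `L'` on the truncated pair
  have key : ∀ z : List Bool, z.length = p.eval n + A.eval n + h →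
      (boolPair e (boolPair (boolPair x z) []) ∈ U₂ ↔ boolPair x (z.take (p.eval n)) ∈ L') := by
    intro z hz
    have hrun : Mhat.OutputsWithin (boolPair x z)
        (encodeBool (L'.boolIndicator (boolPair x (z.take (p.eval n))))) (A.eval n + z.length) :=
      hMhat x z
    constructor
    · intro hmem
      obtain ⟨t, ht⟩ := hsound (boolPair x z) [] hmem
      have heq := outputsWithin_unique Mhat ht hrun
      have hb : L'.boolIndicator (boolPair x (z.take (p.eval n))) = true := by
        have h1 : encodeBool (L'.boolIndicator (boolPair x (z.take (p.eval n)))) =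
            [L'.boolIndicator (boolPair x (z.take (p.eval n)))] := rfl
        rw [h1] at heq
        simpa using heq.symm
      exact (Set.mem_iff_boolIndicator _ _).2 hb
    · intro hmem
      have hb : L'.boolIndicator (boolPair x (z.take (p.eval n))) = true :=
        (Set.mem_iff_boolIndicator _ _).1 hmem
      have hrun' : Mhat.OutputsWithin (boolPair x z) [true] (A.eval n + z.length) := by
        rw [hb] at hrun
        exact hrun
      refine hcomplete (boolPair x z) [] (A.eval n + z.length) hrun' ?_
      simp only [length_boolPair, List.length_nil]
      exact budget_le h (A.eval n) (p.eval n) e.length n z.length hz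
  -- the success probability is the cylinder probability of `L'`'s event
  have hx := hbp x
  have hle : p.eval n ≤ (p + A + C h).eval n := by simp only [eval_add, eval_C]; omega
  rw [← uniformProb_take_of_le hle] at hx
  refine hx.trans_eq (uniformProb_congr fun r hr => ?_)
  have hr' : r.length = p.eval n + A.eval n + h := by rw [hr]; simp
  -- both memberships unfold (definitionally) to the two sides of `key`
  exact iff_congr (key r hr').symm Iff.rfl

/-- `QuadQ`, the route's inlined comprehension (verbatim), lies in `BQP` (an `O(n²)` encoder time
bound is the polynomial `C C * X ^ 2 + C C`; as in `Disproof.lean`). -/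
theorem quadQ_subset_BQP :
    {L : Language Bool | ∃ F : QCircuitFamily cliffordT, F.IsOracleFree ∧
      (∃ C : ℕ, TimeComputable _root_.Computability.unaryEncodeNat (QCircuit.sigmaEncode (G := cliffordT))
        (fun n => (⟨n, F.ancillas n, F.circ n⟩ : Σ n m : ℕ, QCircuit cliffordT (n + m)))
        (fun n => C * n ^ 2 + C)) ∧
      ∀ x, (x ∈ L → 2 / 3 ≤ F.acceptProbOn 0 x) ∧ (x ∉ L → F.acceptProbOn 0 x ≤ 1 / 3)} ⊆ BQP := by
  rintro L ⟨F, hfree, ⟨C, hT⟩, hgap⟩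
  rw [ClassBQP.mem_BQP_iff]
  refine ⟨F, hfree, ⟨Polynomial.C C * Polynomial.X ^ 2 + Polynomial.C C, ?_⟩, hgap⟩
  exact hT.mono fun n => le_of_eq (by simp)

/-- **The crux `CompactnessPrinciple` (stmt-QuantumAdvantage-15270) AS TYPED**: under `BQP ⊆ BPP`,
`QuadQ ⊆ BQP ⊆ BPP ⊆ bp (DTIME n^{c₀})` with the ONE exponent of `paddingCollapse`. HONEST LABEL:
a coin-padding theorem of the typing (`bp (DTIME ·)` clocks the inner language on the padded pair and
allows any polynomial coin length), with zero quantum content — not the intended uniform-exponent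
principle over `BQTime`/`BPTime` (refuters rreview-0816 / rattack-15270-0; the planner restates). -/
theorem compactnessPrinciple_proof :
    Summit.QuantumAdvantage.QuantumAdvantage.Theses.CompactnessLift.CompactnessPrinciple := by
  intro hsub
  obtain ⟨c₀, hc₀⟩ := paddingCollapse
  exact ⟨c₀, fun L hL => hc₀ (hsub (quadQ_subset_BQP hL))⟩

end Summit.QuantumAdvantage.QuantumAdvantage.Theorems.CompactnessLiftPadding
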